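import Literature.AlgebraicGeometry.Motives.StandardConjecturesSl2Proofs
import Literature.AlgebraicGeometry.Motives.StandardConjecturesLefschetzProofs
import Literature.AlgebraicGeometry.Motives.CorrespondencesHyperplaneProofs
import HarnessLib

/-!
# `ᶜΛ` algebraic implies `B(X)` (Kleiman 1968, Prop. 2.3, via the `θ`-form)

For a Weil cohomology theory `W : WeilCohomology k K` with the hard Lefschetz property, `X` smooth
projective of dimension `n` with hyperplane class `η`, this file proves: **if Kleiman's operator
`ᶜΛ` (`StandardConjecturesSl2Proofs.clambdaOp`) is induced by algebraic correspondences with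
`ℚ`-coefficients, then Grothendieck's standard conjecture of Lefschetz type `B(X, η)` holds in
`θ`-form** (`standardConjectureB_of_isAlgebraicGradedOp_clambdaOp`; S. Kleiman, *Algebraic cycles
and the Weil conjectures* (1968), Prop. 2.3 with 1.4.4: `B(X) ⇔ θⁱ algebraic ⇔ Λ algebraic ⇔ ᶜΛ`
algebraic; J. J. Ramón Marí 2008, Prop. 2.5). This is the last step of the proof of
`D(X × X) ⇒ B(X)` (Kleiman 1968, Thm. 2.9 with §3), where `ᶜΛ` is shown to be algebraic.

## The argument (formal in the axioms of `WeilCohomology`)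

1. **Künneth projectors from `L` and `ᶜΛ`** (`isAlgebraicOperator_id_of_isAlgebraicGradedOp_clambdaOp`,
   Kleiman 1968 §1.4: the `πᵃ` are polynomials in `L` and `ᶜΛ`): the graded commutator
   `h = L ∘ ᶜΛ - ᶜΛ ∘ L` is algebraic (`isAlgebraicGradedOp_comp_holds`,
   `exists_isAlgebraicGradedOp_lefschetzPow`) and is the diagonal operator `deg - n`
   (`lefschetz_clambda_sub_clambda_lefschetz`); the Lagrange interpolation product
   `∏_{b ≠ a, b ≤ 2n} (h - (b - n)) / (a - b)` is algebraic and equals the projector `πᵃ`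
   (diagonal graded operators compose valuewise, `diagOp_comp_diagOp`).
2. **Components of algebraic graded operators are algebraic** once the `πᵃ` are
   (`ofLinearMap (T a b) = πᵇ ∘ T ∘ πᵃ`), so every component of `ᶜΛ` and the iterate
   `Φ = ᶜΛʳ : H²ⁿ⁻ⁱ(X) → Hⁱ(X)` (`clambdaIter`) are algebraic (`IsAlgebraicOperator.comp`).
3. **`w = Φ ∘ Lʳ` is an algebraic automorphism of `Hⁱ(X)`**: it acts on the Lefschetz summand
   `Lᵗ Pⁱ'(X)` by the positive integer `∏ₛ (t + s + 1)(t + r - s)` (`clambdaIter_apply_lefschetzPow`,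
   the iterated string formula), hence is injective (`summandScaleOp_injective`), hence bijective.
4. **Cayley–Hamilton** (as in `CorrespondencesHyperplaneProofs`): the powers of `w` are algebraic
   and have rational traces (`exists_rat_trace_of_isAlgebraicOperator`, Lefschetz trace formula), so
   `w⁻¹ ∈ ℚ[w]` (`LinearMap.exists_inverse_eq_sum_ratCast_smul_pow`) is algebraic, and
   `θⁱ = w⁻¹ ∘ Φ` is an algebraic two-sided inverse of `Lʳ` (hard Lefschetz).

No named fact is introduced; nothing existing is restated. Definitions: `diagOp`, `lagrangeOp`,
`clambdaIter`, `iterCoeff`, `summandScaleOp` (explicit).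

## References

* S. Kleiman, *Algebraic cycles and the Weil conjectures*, in: Dix exposés sur la cohomologie des
  schémas, North-Holland (1968), 359–386, §1.4 (1.4.4, 1.4.6), §2 (Prop. 2.3), Prop. 1.3.6.
  [Kleiman1968AlgebraicCycles]
* J. J. Ramón Marí, *On the Lefschetz standard conjecture*, arXiv:math/0703005 (2008), Prop. 2.5.
-/

universe u v

open CategoryTheory AlgebraicGeometry MonoidalCategory CartesianMonoidalCategory
open scoped DirectSum TensorProduct

noncomputable section

namespace Literature.AlgebraicGeometry.Motives

/-! ## Graded operators: components as sandwiches, diagonal operators -/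

namespace PreWeilCohomology

namespace GradedOp

variable {k : Type u} [Field k] {K : Type v} [Field K] {W : PreWeilCohomology k K}
variable {X Y : SchemeOver k}

/-- **A component of a graded operator as a composite**: `πᵇ ∘ T ∘ πᵃ`, with `πᵃ`, `πᵇ` the graded
operators concentrated in bidegrees `(a, a)`, `(b, b)` with component the identity, is the graded
operator concentrated in bidegree `(a, b)` with component `T a b`. [folklore] -/
theorem ofLinearMap_id_comp_comp_ofLinearMap_id (T : W.GradedOp X Y) (a b : ℕ) :
    (ofLinearMap (LinearMap.id : W.obj Y b →ₗ[K] W.obj Y b)).comp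
        (T.comp (ofLinearMap (LinearMap.id : W.obj X a →ₗ[K] W.obj X a))) =
      ofLinearMap (T a b) := by
  funext i j
  have h₁ : (ofLinearMap (LinearMap.id : W.obj Y b →ₗ[K] W.obj Y b)).comp
      (T.comp (ofLinearMap (LinearMap.id : W.obj X a →ₗ[K] W.obj X a))) i j =
      (ofLinearMap (LinearMap.id : W.obj Y b →ₗ[K] W.obj Y b) b j).comp
        ((T.comp (ofLinearMap (LinearMap.id : W.obj X a →ₗ[K] W.obj X a))) i b) := by
    refine finsum_eq_single _ b fun m hm ↦ ?_
    rw [ofLinearMap_apply_of_ne _ (fun hh ↦ hm hh.1.symm), LinearMap.zero_comp]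
  have h₂ : (T.comp (ofLinearMap (LinearMap.id : W.obj X a →ₗ[K] W.obj X a))) i b =
      (T a b).comp (ofLinearMap (LinearMap.id : W.obj X a →ₗ[K] W.obj X a) i a) := by
    refine finsum_eq_single _ a fun m hm ↦ ?_
    rw [ofLinearMap_apply_of_ne _ (fun hh ↦ hm hh.2.symm), LinearMap.comp_zero]
  rw [h₁, h₂]
  by_cases hj : b = j
  · subst hj
    rw [ofLinearMap_apply_same, LinearMap.id_comp]
    by_cases hi : a = i
    · subst hi
      rw [ofLinearMap_apply_same, LinearMap.comp_id, ofLinearMap_apply_same]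
    · rw [ofLinearMap_apply_of_ne _ (fun hh ↦ hi hh.1), LinearMap.comp_zero,
        ofLinearMap_apply_of_ne _ (fun hh ↦ hi hh.1)]
  · rw [ofLinearMap_apply_of_ne _ (fun hh ↦ hj hh.2), LinearMap.zero_comp,
      ofLinearMap_apply_of_ne _ (fun hh ↦ hj hh.2)]

variable (W X) in
/-- The **diagonal graded operator** with values `φ`: component `(a, a)` equal to `φ a · id`, all
other components zero. [folklore] -/
def diagOp (φ : ℕ → K) : W.GradedOp X X := fun a b ↦
  φ a • ofLinearMap (LinearMap.id : W.obj X a →ₗ[K] W.obj X a) a b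

/-- The diagonal components of a diagonal operator. [folklore] -/
@[simp]
theorem diagOp_apply_same (φ : ℕ → K) (a : ℕ) :
    diagOp W X φ a a = φ a • (LinearMap.id : W.obj X a →ₗ[K] W.obj X a) := by
  rw [diagOp, ofLinearMap_apply_same]

/-- The off-diagonal components of a diagonal operator vanish. [folklore] -/
theorem diagOp_apply_of_ne (φ : ℕ → K) {a b : ℕ} (h : a ≠ b) : diagOp W X φ a b = 0 := by
  rw [diagOp, ofLinearMap_apply_of_ne _ (fun hh ↦ h hh.2), smul_zero]

/-- Diagonal operators compose valuewise. [folklore] -/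
theorem diagOp_comp_diagOp (φ ψ : ℕ → K) :
    (diagOp W X φ).comp (diagOp W X ψ) = diagOp W X (φ * ψ) := by
  funext i j
  have h₁ : (diagOp W X φ).comp (diagOp W X ψ) i j = (diagOp W X φ i j).comp (diagOp W X ψ i i) := by
    refine finsum_eq_single _ i fun m hm ↦ ?_
    rw [diagOp_apply_of_ne ψ (Ne.symm hm), LinearMap.comp_zero]
  rw [h₁, diagOp_apply_same]
  by_cases hij : i = j
  · subst hij
    rw [diagOp_apply_same, diagOp_apply_same, LinearMap.smul_comp, LinearMap.comp_smul,
      LinearMap.id_comp, smul_smul, Pi.mul_apply]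
  · rw [diagOp_apply_of_ne φ hij, diagOp_apply_of_ne _ hij, LinearMap.zero_comp]

/-- Linear combinations of diagonal operators. [folklore] -/
theorem diagOp_sub_smul_diagOp (φ ψ : ℕ → K) (c : K) :
    diagOp W X φ - c • diagOp W X ψ = diagOp W X (fun a ↦ φ a - c * ψ a) := by
  funext a b
  simp only [diagOp, Pi.sub_apply, Pi.smul_apply, sub_smul, smul_smul]

/-- Scalar multiples of diagonal operators. [folklore] -/
theorem smul_diagOp (φ : ℕ → K) (c : K) : c • diagOp W X φ = diagOp W X (fun a ↦ c * φ a) := by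
  funext a b
  simp only [diagOp, Pi.smul_apply, smul_smul]

end GradedOp

end PreWeilCohomology

namespace WeilCohomology

variable {k : Type u} [Field k] {K : Type v} [Field K] [CharZero K] (W : WeilCohomology k K)
variable {n : ℕ} {X Y : SchemeOver k} {η : W.obj X 2}

/-! ## Closure properties of algebraic graded operators (complementing `StandardConjecturesLefschetzProofs`) -/

section Closure

variable {W} {nX nY : ℕ}

/-- Rational multiples of algebraic graded operators are algebraic. [folklore] -/
theorem _root_.Literature.AlgebraicGeometry.Motives.PreWeilCohomology.IsAlgebraicGradedOp.ratCast_smul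
    {T : W.GradedOp X Y} (hT : W.IsAlgebraicGradedOp nX nY T)
    (q : ℚ) : W.IsAlgebraicGradedOp nX nY ((q : K) • T) := by
  obtain ⟨u, hu, hu0⟩ := hT
  refine ⟨fun c ↦ ⟨(q : K) • (u c : W.obj (X ⊗ Y) (2 * c)),
    W.ratCast_smul_mem_ratAlgebraicClasses (u c).2 q⟩, fun i j c j' hj hm hc ↦ ?_, fun i j h ↦ ?_⟩
  · rw [Pi.smul_apply, Pi.smul_apply]
    exact (hu i j c j' hj hm hc).smul (q : K)
  · rw [Pi.smul_apply, Pi.smul_apply, hu0 i j h, smul_zero]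

/-- `K`-multiples by a scalar that happens to be rational. [folklore] -/
theorem _root_.Literature.AlgebraicGeometry.Motives.PreWeilCohomology.IsAlgebraicGradedOp.smul_of_eq_ratCast
    {T : W.GradedOp X Y}
    (hT : W.IsAlgebraicGradedOp nX nY T) {c : K} (q : ℚ) (hc : c = q) :
    W.IsAlgebraicGradedOp nX nY (c • T) := by
  rw [hc]
  exact hT.ratCast_smul q

end Closure

/-! ## The identity graded operator and diagonal operators are algebraic -/

/-- **The identity graded operator is algebraic**: the class of the diagonal `Δ ∈ Aⁿ(X × X)_ℚ`
induces `id` on every `Hᵃ(X)` (axiom `exists_isInducedBy_id`), and the off-diagonal components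
vanish. [cite: Kleiman1968AlgebraicCycles, §1.3] -/
theorem isAlgebraicGradedOp_diagOp_one (hX : IsSmoothProjective n X) :
    W.IsAlgebraicGradedOp n n (PreWeilCohomology.GradedOp.diagOp W.toPreWeilCohomology X
      fun _ ↦ (1 : K)) := by
  classical
  obtain ⟨Δ, hΔmem, hΔ⟩ := W.exists_isInducedBy_id hX
  refine ⟨Function.update (fun _ ↦ 0) n ⟨Δ, hΔmem⟩, fun i j c j' hj hm hc ↦ ?_, fun i j h ↦ ?_⟩
  · by_cases hcn : c = n
    · subst hcn
      obtain rfl : i = j := by omega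
      rw [Function.update_self, PreWeilCohomology.GradedOp.diagOp_apply_same, one_smul]
      exact hΔ i j' hj
    · have hij : i ≠ j := by omega
      rw [Function.update_of_ne hcn, PreWeilCohomology.GradedOp.diagOp_apply_of_ne _ hij,
        AddSubgroup.coe_zero]
      exact W.isInducedBy_zero
  · have hij : i ≠ j := fun hij ↦ h ⟨n, by omega⟩
    exact PreWeilCohomology.GradedOp.diagOp_apply_of_ne _ hij

/-! ## The graded commutator `[L, ᶜΛ]` is the diagonal operator `deg - n` -/

section Commutator

variable {W}

/-- Components of `L ∘ ᶜΛ`: for a graded operator `E` agreeing with `L` in bidegrees `(a, a + 2)`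
and vanishing elsewhere, `(E ∘ ᶜΛ) (b + 2, j)` is the one-term composite through degree `b`. [folklore] -/
theorem comp_clambdaOp_apply (hL : W.HasHardLefschetz) (hX : IsSmoothProjective n X)
    (hη : W.IsHyperplaneClass X η) (E : W.GradedOp X X) {b a : ℕ} (hba : b + 2 = a) (j : ℕ) :
    E.comp (W.clambdaOp hL hX hη) a j = (E b j).comp (W.clambdaOp hL hX hη a b) := by
  refine finsum_eq_single _ b fun m hm ↦ ?_
  rw [W.clambdaOp_eq_zero_of_ne hL hX hη (show m + 2 ≠ a by omega), LinearMap.comp_zero]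

/-- `(E ∘ ᶜΛ) (a, j) = 0` for `a ≤ 1` (no degree `a - 2`). [folklore] -/
theorem comp_clambdaOp_apply_of_le_one (hL : W.HasHardLefschetz) (hX : IsSmoothProjective n X)
    (hη : W.IsHyperplaneClass X η) (E : W.GradedOp X X) {a : ℕ} (ha : a ≤ 1) (j : ℕ) :
    E.comp (W.clambdaOp hL hX hη) a j = 0 := by
  refine finsum_eq_zero_of_forall_eq_zero fun m ↦ ?_
  rw [W.clambdaOp_eq_zero_of_ne hL hX hη (show m + 2 ≠ a by omega), LinearMap.comp_zero]

/-- Components of `ᶜΛ ∘ E`: the one-term composite through degree `a + 2`. [folklore] -/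
theorem clambdaOp_comp_apply (hL : W.HasHardLefschetz) (hX : IsSmoothProjective n X)
    (hη : W.IsHyperplaneClass X η) {E : W.GradedOp X X}
    (hE₀ : ∀ ⦃a b : ℕ⦄, ¬ a + 2 * 1 = b → E a b = 0) (a j : ℕ) :
    (W.clambdaOp hL hX hη).comp E a j = (W.clambdaOp hL hX hη (a + 2) j).comp (E a (a + 2)) := by
  refine finsum_eq_single _ (a + 2) fun m hm ↦ ?_
  rw [hE₀ (show ¬ a + 2 * 1 = m by omega), LinearMap.comp_zero]

/-- **`[L, ᶜΛ] = deg - n`** as graded operators (Kleiman 1968, 1.4.6): for `E` the graded operator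
of `L` (component `L` in bidegrees `(a, a + 2)`, zero elsewhere),
`E ∘ ᶜΛ - ᶜΛ ∘ E = diag (a ↦ a - n)` (`lefschetz_clambda_sub_clambda_lefschetz`,
`clambda_lefschetz_of_le_one`). [cite: Kleiman1968AlgebraicCycles, §1.4 (1.4.6)] -/
theorem comp_clambdaOp_sub_clambdaOp_comp (hL : W.HasHardLefschetz) (hX : IsSmoothProjective n X)
    (hη : W.IsHyperplaneClass X η) {E : W.GradedOp X X}
    (hE : ∀ ⦃a b : ℕ⦄ (h : a + 2 * 1 = b), E a b = W.lefschetzPow X η 1 a b h)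
    (hE₀ : ∀ ⦃a b : ℕ⦄, ¬ a + 2 * 1 = b → E a b = 0) :
    E.comp (W.clambdaOp hL hX hη) - (W.clambdaOp hL hX hη).comp E =
      PreWeilCohomology.GradedOp.diagOp W.toPreWeilCohomology X fun a ↦ ((a : K) - n) := by
  funext a j
  rw [Pi.sub_apply, Pi.sub_apply, W.clambdaOp_comp_apply hL hX hη hE₀ a j]
  by_cases haj : a = j
  · subst haj
    rw [PreWeilCohomology.GradedOp.diagOp_apply_same, hE (rfl : a + 2 * 1 = a + 2)]
    by_cases ha : 2 ≤ a
    · obtain ⟨b, rfl⟩ : ∃ b, a = b + 2 := ⟨a - 2, by omega⟩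
      rw [W.comp_clambdaOp_apply hL hX hη E rfl, hE (rfl : b + 2 * 1 = b + 2)]
      refine LinearMap.ext fun y ↦ ?_
      rw [LinearMap.sub_apply, LinearMap.comp_apply, LinearMap.comp_apply,
        W.lefschetz_clambda_sub_clambda_lefschetz hL hX hη rfl rfl y, LinearMap.smul_apply,
        LinearMap.id_apply]
      congr 1
      push_cast
      ring
    · rw [W.comp_clambdaOp_apply_of_le_one hL hX hη E (by omega), zero_sub]
      refine LinearMap.ext fun y ↦ ?_
      rw [LinearMap.neg_apply, LinearMap.comp_apply,
        W.clambda_lefschetz_of_le_one hL hX hη (by omega) rfl y, LinearMap.smul_apply,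
        LinearMap.id_apply, ← neg_smul]
      congr 1
      push_cast
      ring
  · rw [PreWeilCohomology.GradedOp.diagOp_apply_of_ne _ haj,
      W.clambdaOp_eq_zero_of_ne hL hX hη (show j + 2 ≠ a + 2 by omega), LinearMap.zero_comp,
      sub_zero]
    by_cases ha : 2 ≤ a
    · obtain ⟨b, rfl⟩ : ∃ b, a = b + 2 := ⟨a - 2, by omega⟩
      rw [W.comp_clambdaOp_apply hL hX hη E rfl, hE₀ (show ¬ b + 2 * 1 = j by omega),
        LinearMap.zero_comp]
    · exact W.comp_clambdaOp_apply_of_le_one hL hX hη E (by omega) j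

end Commutator

/-! ## The Künneth projectors as Lagrange polynomials in `[L, ᶜΛ]` -/

section Lagrange

variable {W}

/-- The **Lagrange interpolation product** `∏_{b ∈ l} (a₀ - b)⁻¹ (h - (b - n) I)` of graded operators
(for `h = [L, ᶜΛ]`, `I` the identity graded operator), as an iterated composite. [folklore] -/
def lagrangeOp (h I : W.GradedOp X X) (n a₀ : ℕ) : List ℕ → W.GradedOp X X
  | [] => I
  | b :: l => (((a₀ : K) - b)⁻¹ • (h - ((b : K) - n) • I)).comp (lagrangeOp h I n a₀ l)

/-- The Lagrange product of algebraic graded operators is algebraic (composition, rational linear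
combinations). [folklore] -/
theorem isAlgebraicGradedOp_lagrangeOp (hX : IsSmoothProjective n X) {h I : W.GradedOp X X}
    (hh : W.IsAlgebraicGradedOp n n h) (hI : W.IsAlgebraicGradedOp n n I) (a₀ : ℕ) :
    ∀ l : List ℕ, W.IsAlgebraicGradedOp n n (lagrangeOp h I n a₀ l)
  | [] => hI
  | b :: l => by
    rw [lagrangeOp]
    refine W.isAlgebraicGradedOp_comp_holds hX hX hX ?_ (isAlgebraicGradedOp_lagrangeOp hX hh hI a₀ l)
    refine (hh.sub W.toPreWeilCohomology
      (hI.smul_of_eq_ratCast ((b : ℚ) - n) (by push_cast; ring))).smul_of_eq_ratCast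
      (((a₀ : ℚ) - b)⁻¹) (by push_cast; ring)

/-- The Lagrange product of diagonal operators is the diagonal operator of the product of the
values. [folklore] -/
theorem lagrangeOp_diagOp (a₀ : ℕ) :
    ∀ l : List ℕ, lagrangeOp (PreWeilCohomology.GradedOp.diagOp W.toPreWeilCohomology X
        fun a ↦ ((a : K) - n))
      (PreWeilCohomology.GradedOp.diagOp W.toPreWeilCohomology X fun _ ↦ (1 : K)) n a₀ l =
      PreWeilCohomology.GradedOp.diagOp W.toPreWeilCohomology X fun a ↦
        (l.map fun b : ℕ ↦ ((a₀ : K) - (b : K))⁻¹ * ((a : K) - (b : K))).prod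
  | [] => by
    funext a b
    simp only [lagrangeOp, PreWeilCohomology.GradedOp.diagOp, List.map_nil, List.prod_nil]
  | b :: l => by
    rw [lagrangeOp, lagrangeOp_diagOp a₀ l, PreWeilCohomology.GradedOp.diagOp_sub_smul_diagOp,
      PreWeilCohomology.GradedOp.smul_diagOp, PreWeilCohomology.GradedOp.diagOp_comp_diagOp]
    congr 1
    funext a
    rw [Pi.mul_apply, List.map_cons, List.prod_cons]
    ring

/-- **The Künneth projectors are algebraic once `ᶜΛ` is** (Kleiman 1968 §1.4 and Prop. 2.3: the
`πᵃ` are universal polynomials in `L` and `ᶜΛ`; here the Lagrange interpolation polynomial in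
`h = [L, ᶜΛ]`, which acts on `Hᵃ(X)` by `a - n`). [cite: Kleiman1968AlgebraicCycles, §1.4 and Prop. 2.3] -/
theorem isAlgebraicOperator_id_of_isAlgebraicGradedOp_clambdaOp (hL : W.HasHardLefschetz)
    (hX : IsSmoothProjective n X) (hη : W.IsHyperplaneClass X η)
    (hF : W.IsAlgebraicGradedOp n n (W.clambdaOp hL hX hη)) (a₀ : ℕ) :
    W.IsAlgebraicOperator n n (LinearMap.id : W.obj X a₀ →ₗ[K] W.obj X a₀) := by
  classical
  by_cases ha₀ : 2 * n < a₀
  · haveI := W.subsingleton_obj hX ha₀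
    change W.IsAlgebraicGradedOp n n _
    rw [PreWeilCohomology.GradedOp.ofLinearMap_eq_zero_of_subsingleton]
    exact W.isAlgebraicGradedOp_zero n n
  -- `h = [E, ᶜΛ]` and `I` are algebraic diagonal operators
  have hη₁ : η ∈ W.ratAlgebraicClasses X 1 := by
    have h1 := W.pow_mem_ratAlgebraicClasses_of_isHyperplaneClass hX hη (le_refl 1)
    rwa [show W.pow X η 1 = η from W.one_cup hX rfl η] at h1
  obtain ⟨E, hE, hE₀, hEalg⟩ := W.exists_isAlgebraicGradedOp_lefschetzPow hX hη₁ 1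
  have hI := W.isAlgebraicGradedOp_diagOp_one hX
  have hh : W.IsAlgebraicGradedOp n n (E.comp (W.clambdaOp hL hX hη) - (W.clambdaOp hL hX hη).comp E) :=
    (W.isAlgebraicGradedOp_comp_holds hX hX hX hEalg hF).sub W.toPreWeilCohomology
      (W.isAlgebraicGradedOp_comp_holds hX hX hX hF hEalg)
  rw [W.comp_clambdaOp_sub_clambdaOp_comp hL hX hη hE hE₀] at hh
  -- the Lagrange product over `b ≤ 2n`, `b ≠ a₀`
  set l : List ℕ := ((Finset.range (2 * n + 1)).erase a₀).toList with hl
  have halg := isAlgebraicGradedOp_lagrangeOp hX hh hI a₀ l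
  rw [lagrangeOp_diagOp] at halg
  -- its values: `1` at `a₀`, `0` at `a ≤ 2n`, `a ≠ a₀`
  have hval₁ : (l.map fun b : ℕ ↦ ((a₀ : K) - (b : K))⁻¹ * ((a₀ : K) - (b : K))).prod = 1 := by
    refine List.prod_eq_one fun x hx ↦ ?_
    obtain ⟨b, hb, rfl⟩ := List.mem_map.mp hx
    have hb' : b ≠ a₀ := by
      rw [hl, Finset.mem_toList, Finset.mem_erase] at hb
      exact hb.1
    exact inv_mul_cancel₀ (sub_ne_zero.mpr (fun h ↦ hb' (by exact_mod_cast h.symm)))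
  have hval₀ : ∀ a, a ≤ 2 * n → a ≠ a₀ →
      (l.map fun b : ℕ ↦ ((a₀ : K) - (b : K))⁻¹ * ((a : K) - (b : K))).prod = 0 := by
    intro a ha hne
    refine List.prod_eq_zero (List.mem_map.mpr ⟨a, ?_, by rw [sub_self, mul_zero]⟩)
    rw [hl, Finset.mem_toList, Finset.mem_erase, Finset.mem_range]
    exact ⟨hne, by omega⟩
  -- the diagonal operator is the projector `πᵃ⁰`
  change W.IsAlgebraicGradedOp n n _
  convert halg using 1
  funext a b
  by_cases hab : a = b
  · subst hab
    rw [PreWeilCohomology.GradedOp.diagOp_apply_same]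
    by_cases haa : a = a₀
    · subst haa
      rw [hval₁, one_smul, PreWeilCohomology.GradedOp.ofLinearMap_apply_same]
    · rw [PreWeilCohomology.GradedOp.ofLinearMap_apply_of_ne _ (fun hh ↦ haa hh.1.symm)]
      by_cases ha : a ≤ 2 * n
      · rw [hval₀ a ha haa, zero_smul]
      · haveI := W.subsingleton_obj hX (i := a) (by omega)
        exact LinearMap.ext fun x ↦ Subsingleton.elim _ _
  · rw [PreWeilCohomology.GradedOp.diagOp_apply_of_ne _ hab,
      PreWeilCohomology.GradedOp.ofLinearMap_apply_of_ne _ (fun hh ↦ hab (hh.1.symm.trans hh.2))]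

/-- **Components of `ᶜΛ` are algebraic** once `ᶜΛ` is (`ofLinearMap (ᶜΛ a b) = πᵇ ∘ ᶜΛ ∘ πᵃ` and
the Künneth projectors are algebraic). [cite: Kleiman1968AlgebraicCycles, Prop. 2.3] -/
theorem isAlgebraicOperator_clambdaOp (hL : W.HasHardLefschetz) (hX : IsSmoothProjective n X)
    (hη : W.IsHyperplaneClass X η) (hF : W.IsAlgebraicGradedOp n n (W.clambdaOp hL hX hη))
    (a b : ℕ) : W.IsAlgebraicOperator n n (W.clambdaOp hL hX hη a b) := by
  have h := W.isAlgebraicGradedOp_comp_holds hX hX hX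
    (W.isAlgebraicOperator_id_of_isAlgebraicGradedOp_clambdaOp hL hX hη hF b)
    (W.isAlgebraicGradedOp_comp_holds hX hX hX hF
      (W.isAlgebraicOperator_id_of_isAlgebraicGradedOp_clambdaOp hL hX hη hF a))
  change W.IsAlgebraicGradedOp n n _
  rwa [PreWeilCohomology.GradedOp.ofLinearMap_id_comp_comp_ofLinearMap_id] at h

end Lagrange

/-! ## The iterate `ᶜΛʳ` and its action on the Lefschetz summands -/

section Iterate

/-- The **iterated lowering operator** `ᶜΛʳ : Hⁱ⁺²ʳ(X) → Hⁱ(X)` (composite of the components of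
`ᶜΛ`). [folklore] -/
def clambdaIter (hL : W.HasHardLefschetz) (hX : IsSmoothProjective n X)
    (hη : W.IsHyperplaneClass X η) (i : ℕ) : (r : ℕ) → (W.obj X (i + 2 * r) →ₗ[K] W.obj X i)
  | 0 => LinearMap.id
  | r + 1 => clambdaIter hL hX hη i r ∘ₗ W.clambdaOp hL hX hη (i + 2 * (r + 1)) (i + 2 * r)

/-- `ᶜΛʳ` is algebraic when the components of `ᶜΛ` and the projector `πⁱ` are. [folklore] -/
theorem isAlgebraicOperator_clambdaIter (hL : W.HasHardLefschetz) (hX : IsSmoothProjective n X)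
    (hη : W.IsHyperplaneClass X η)
    (hFc : ∀ a b : ℕ, W.IsAlgebraicOperator n n (W.clambdaOp hL hX hη a b)) (i : ℕ)
    (hid : W.IsAlgebraicOperator n n (LinearMap.id : W.obj X i →ₗ[K] W.obj X i)) :
    ∀ r : ℕ, W.IsAlgebraicOperator n n (W.clambdaIter hL hX hη i r)
  | 0 => hid
  | r + 1 => (isAlgebraicOperator_clambdaIter hL hX hη hFc i hid r).comp hX hX hX (hFc _ _)

/-- The integer by which `ᶜΛʳ ∘ Lʳ` acts on the Lefschetz summand `Lᵗ Pⁱ'(X)`: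
`∏_{s < r} (t + s + 1)(n - i' - t - s)` (product of the string coefficients of `ᶜΛ`). [folklore] -/
def iterCoeff (n i' t r : ℕ) : ℤ := ∏ s ∈ Finset.range r, ((t + s + 1) * ((n : ℤ) - i' - (t + s)))

/-- **Iterated string formula**: `ᶜΛʳ (Lᵗ⁺ʳ x) = iterCoeff • Lᵗ x` for `x ∈ Pⁱ'(X)` primitive
(`clambdaOp_apply_lefschetzPow_succ` iterated). [cite: Kleiman1968AlgebraicCycles, §1.4 (1.4.6)] -/
theorem clambdaIter_apply_lefschetzPow (hL : W.HasHardLefschetz) (hX : IsSmoothProjective n X)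
    (hη : W.IsHyperplaneClass X η) {i' t i : ℕ} (h : i' + 2 * t = i) {x : W.obj X i'}
    (hx : W.IsPrimitive n η x) :
    ∀ (r : ℕ) (hr : i' + 2 * (t + r) = i + 2 * r),
      W.clambdaIter hL hX hη i r (W.lefschetzPow X η (t + r) i' (i + 2 * r) hr x) =
        ((iterCoeff n i' t r : ℤ) : K) • W.lefschetzPow X η t i' i h x
  | 0, hr => by
    simp only [clambdaIter, iterCoeff, Finset.prod_range_zero, Int.cast_one, one_smul,
      LinearMap.id_apply]
    rfl
  | r + 1, hr => by
    rw [clambdaIter, LinearMap.comp_apply]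
    have h₁ : i' + 2 * (t + r + 1) = i + 2 * (r + 1) := by omega
    have hstep : W.clambdaOp hL hX hη (i + 2 * (r + 1)) (i + 2 * r)
        (W.lefschetzPow X η (t + (r + 1)) i' (i + 2 * (r + 1)) hr x) =
        (((t + r + 1) * ((n : ℤ) - i' - (t + r)) : ℤ) : K) •
          W.lefschetzPow X η (t + r) i' (i + 2 * r) (by omega) x :=
      W.clambdaOp_apply_lefschetzPow_succ hL hX hη (t := t + r) h₁ (by omega) hx
    rw [hstep, map_smul, clambdaIter_apply_lefschetzPow hL hX hη h hx r, smul_smul, ← Int.cast_mul,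
      iterCoeff, iterCoeff, Finset.prod_range_succ]
    congr 1
    push_cast
    ring

/-- The coefficient is positive on the summands of `Hⁱ(X)` when `i + r = n`: each factor
`n - i' - t - s = t + r - s` (`s < r`) is positive. [folklore] -/
theorem iterCoeff_pos {i' t r : ℕ} (h : i' + 2 * t + r = n) : 0 < iterCoeff n i' t r := by
  refine Finset.prod_pos fun s hs ↦ ?_
  have hs' := Finset.mem_range.mp hs
  apply mul_pos <;> omega

/-- The operator on `Hⁱ(X)` acting on the Lefschetz summand `p` by the scalar `κ p` (through the
Lefschetz decomposition `lefschetzDecomposition`). [folklore] -/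
def summandScaleOp (hL : W.HasHardLefschetz) (hX : IsSmoothProjective n X)
    (hη : W.IsHyperplaneClass X η) (i : ℕ) (κ : {p : ℕ × ℕ // p.1 + 2 * p.2 = i} → K) :
    W.obj X i →ₗ[K] W.obj X i :=
  letI := W.lefschetzDecomposition hL hX hη i
  (DirectSum.toModule K _ (W.obj X i) fun p ↦ κ p • (W.lefschetzSummand n η i p).subtype) ∘ₗ
    (DirectSum.decomposeLinearEquiv (W.lefschetzSummand n η i)).toLinearMap

/-- `summandScaleOp κ` acts on the summand `p` by `κ p`. [folklore] -/
theorem summandScaleOp_apply_of_mem (hL : W.HasHardLefschetz) (hX : IsSmoothProjective n X)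
    (hη : W.IsHyperplaneClass X η) {i : ℕ} (κ : {p : ℕ × ℕ // p.1 + 2 * p.2 = i} → K)
    (p : {p : ℕ × ℕ // p.1 + 2 * p.2 = i}) {y : W.obj X i} (hy : y ∈ W.lefschetzSummand n η i p) :
    W.summandScaleOp hL hX hη i κ y = κ p • y := by
  letI := W.lefschetzDecomposition hL hX hη i
  simp only [summandScaleOp, LinearMap.coe_comp, LinearEquiv.coe_coe, Function.comp_apply]
  rw [show y = ((⟨y, hy⟩ : W.lefschetzSummand n η i p) : W.obj X i) from rfl,
    DirectSum.decomposeLinearEquiv_apply_coe, DirectSum.toModule_lof]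
  rfl

/-- **A summand-wise scaling by nonzero scalars is injective** (it has the summand-wise scaling by
the inverse scalars as a left inverse; Lefschetz decomposition). [folklore] -/
theorem summandScaleOp_injective (hL : W.HasHardLefschetz) (hX : IsSmoothProjective n X)
    (hη : W.IsHyperplaneClass X η) {i : ℕ} {κ : {p : ℕ × ℕ // p.1 + 2 * p.2 = i} → K}
    (hκ : ∀ p, κ p ≠ 0) : Function.Injective (W.summandScaleOp hL hX hη i κ) := by
  letI := W.lefschetzDecomposition hL hX hη i
  refine Function.LeftInverse.injective (g := W.summandScaleOp hL hX hη i fun p ↦ (κ p)⁻¹) ?_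
  intro y
  induction y using DirectSum.Decomposition.inductionOn (W.lefschetzSummand n η i) with
  | zero => rw [map_zero, map_zero]
  | homogeneous m =>
    rw [W.summandScaleOp_apply_of_mem hL hX hη κ _ m.2, map_smul,
      W.summandScaleOp_apply_of_mem hL hX hη _ _ m.2, smul_smul, mul_inv_cancel₀ (hκ _), one_smul]
  | add y z hy hz => rw [map_add, map_add, hy, hz]

/-- **`ᶜΛʳ ∘ Lʳ` is the summand-wise scaling by `iterCoeff`** on `Hⁱ(X)` (checked on each Lefschetz
summand `Lᵗ Pⁱ'(X)` by the iterated string formula; `DirectSum.decompose_lhom_ext`). [folklore] -/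
theorem clambdaIter_comp_lefschetzPow_eq (hL : W.HasHardLefschetz) (hX : IsSmoothProjective n X)
    (hη : W.IsHyperplaneClass X η) (i r : ℕ) :
    W.clambdaIter hL hX hη i r ∘ₗ W.lefschetzPow X η r i (i + 2 * r) rfl =
      W.summandScaleOp hL hX hη i fun p ↦ ((iterCoeff n p.1.1 p.1.2 r : ℤ) : K) := by
  letI := W.lefschetzDecomposition hL hX hη i
  refine DirectSum.decompose_lhom_ext (W.lefschetzSummand n η i) fun p ↦ ?_
  refine LinearMap.ext fun y ↦ ?_
  obtain ⟨⟨i', t⟩, hp⟩ := p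
  obtain ⟨x, hx, hxy⟩ := Submodule.mem_map.mp y.2
  have hx' : W.IsPrimitive n η x := (W.mem_primitiveSubmodule X n η x).mp hx
  simp only [LinearMap.comp_apply, Submodule.subtype_apply]
  rw [W.summandScaleOp_apply_of_mem hL hX hη _ _ y.2, ← hxy,
    W.lefschetzPow_lefschetzPow hX η (rfl : t + r = t + r) hp rfl (by have := hp; omega) x,
    W.clambdaIter_apply_lefschetzPow hL hX hη hp hx' r]

/-- **`ᶜΛʳ ∘ Lʳ` is an automorphism of `Hⁱ(X)`** for `i + r = n` (injective as the coefficients are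
positive integers and `char K = 0`; bijective by finite dimensionality). [folklore] -/
theorem bijective_clambdaIter_comp_lefschetzPow (hL : W.HasHardLefschetz)
    (hX : IsSmoothProjective n X) (hη : W.IsHyperplaneClass X η) {i r : ℕ} (hir : i + r = n) :
    Function.Bijective (W.clambdaIter hL hX hη i r ∘ₗ W.lefschetzPow X η r i (i + 2 * r) rfl) := by
  haveI := W.finite_obj hX i
  have hinj : Function.Injective
      (W.clambdaIter hL hX hη i r ∘ₗ W.lefschetzPow X η r i (i + 2 * r) rfl) := by
    rw [W.clambdaIter_comp_lefschetzPow_eq hL hX hη i r]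
    refine W.summandScaleOp_injective hL hX hη fun p ↦ ?_
    exact Int.cast_ne_zero.mpr (iterCoeff_pos (by have := p.2; omega)).ne'
  exact ⟨hinj, LinearMap.injective_iff_surjective.mp hinj⟩

end Iterate

/-! ## `ᶜΛ` algebraic implies `B(X)` -/

/-- **`ᶜΛ` algebraic ⇒ `B(X)`** (Kleiman 1968, Prop. 2.3 with 1.4.4; Ramón Marí 2008, Prop. 2.5):
under hard Lefschetz, for `X` smooth projective of dimension `n` with hyperplane class `η`, if
Kleiman's operator `ᶜΛ` is induced by algebraic correspondences with `ℚ`-coefficients, then the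
standard conjecture of Lefschetz type `B(X, η)` holds in `θ`-form: for `i + r = n` the inverse of
`Lʳ : Hⁱ(X) ⥲ Hⁱ⁺²ʳ(X)` is algebraic. It is `θ = w⁻¹ ∘ ᶜΛʳ` with `w = ᶜΛʳ ∘ Lʳ` the algebraic
automorphism of `Hⁱ(X)` (`bijective_clambdaIter_comp_lefschetzPow`; the `πᵃ` and the components of
`ᶜΛ` being algebraic, `isAlgebraicOperator_id_of_isAlgebraicGradedOp_clambdaOp`,
`isAlgebraicOperator_clambdaOp`), whose inverse is a rational polynomial in `w` by Cayley–Hamilton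
and the rationality of the traces of algebraic correspondences
(`LinearMap.exists_inverse_eq_sum_ratCast_smul_pow`, `exists_rat_trace_of_isAlgebraicOperator`).
[cite: Kleiman1968AlgebraicCycles, §2 Prop. 2.3] -/
theorem standardConjectureB_of_isAlgebraicGradedOp_clambdaOp (hL : W.HasHardLefschetz)
    (hX : IsSmoothProjective n X) (hη : W.IsHyperplaneClass X η)
    (hF : W.IsAlgebraicGradedOp n n (W.clambdaOp hL hX hη)) : W.StandardConjectureB n X η := by
  intro i r j hir hij
  subst hij
  have hid := W.isAlgebraicOperator_id_of_isAlgebraicGradedOp_clambdaOp hL hX hη hF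
  have hFc := W.isAlgebraicOperator_clambdaOp hL hX hη hF
  have hΦ : W.IsAlgebraicOperator n n (W.clambdaIter hL hX hη i r) :=
    W.isAlgebraicOperator_clambdaIter hL hX hη hFc i (hid i) r
  -- `w = ᶜΛʳ ∘ Lʳ`, an algebraic automorphism of `Hⁱ(X)`
  set w : W.obj X i →ₗ[K] W.obj X i :=
    W.clambdaIter hL hX hη i r ∘ₗ W.lefschetzPow X η r i (i + 2 * r) rfl with hw
  have walg : W.IsAlgebraicOperator n n w := hΦ.comp_lefschetzPow hX hX hη rfl
  have wbij : Function.Bijective w := W.bijective_clambdaIter_comp_lefschetzPow hL hX hη hir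
  have hunit : IsUnit w := (Module.End.isUnit_iff w).mpr wbij
  -- Cayley–Hamilton: `w⁻¹ = ∑ qₘ wᵐ` with `qₘ ∈ ℚ`
  haveI := W.finite_obj hX i
  have htr : ∀ m : ℕ, ∃ q : ℚ, LinearMap.trace K _ (w ^ (m + 1)) = q := fun m ↦
    W.exists_rat_trace_of_isAlgebraicOperator hX (walg.pow hX (hid i) (m + 1))
  obtain ⟨q, hv, -⟩ := LinearMap.exists_inverse_eq_sum_ratCast_smul_pow w hunit htr
  set v : W.obj X i →ₗ[K] W.obj X i :=
    ∑ m ∈ Finset.range (Module.finrank K (W.obj X i)), ((q m : ℚ) : K) • w ^ m with hv'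
  have valg : W.IsAlgebraicOperator n n v :=
    PreWeilCohomology.IsAlgebraicOperator.sum_ratCast_smul _ q fun m _ ↦ walg.pow hX (hid i) m
  -- `θ = w⁻¹ ∘ ᶜΛʳ` is the algebraic two-sided inverse of `Lʳ`
  have hleft : (v ∘ₗ W.clambdaIter hL hX hη i r) ∘ₗ W.lefschetzPow X η r i (i + 2 * r) rfl =
      LinearMap.id := by
    rw [LinearMap.comp_assoc, ← hw, ← Module.End.mul_eq_comp, hv, Module.End.one_eq_id]
  have hbij : Function.Bijective (W.lefschetzPow X η r i (i + 2 * r) rfl) := hL hX η hη i r _ hir rfl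
  refine ⟨v ∘ₗ W.clambdaIter hL hX hη i r, ⟨hir, hleft, ?_⟩, valg.comp hX hX hX hΦ⟩
  refine LinearMap.ext fun y ↦ ?_
  obtain ⟨x, rfl⟩ := hbij.2 y
  have hx := LinearMap.congr_fun hleft x
  simp only [LinearMap.comp_apply, LinearMap.id_apply] at hx ⊢
  rw [hx]

end WeilCohomology

end Literature.AlgebraicGeometry.Motives

end
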